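import Summits.Ventures.CertifiedManyBodySolver.Theorems.TcThermcert1QbpOrderedExponential
import Summits.Ventures.CertifiedManyBodySolver.Theorems.TcThermcert1QbpGenerator
import Literature.MathematicalPhysics.QuantumLattice.DuhamelTwoPointProofs
import Literature.MathematicalPhysics.QuantumLattice.SpectralSmoothingProofs
import Literature.MathematicalPhysics.QuantumLattice.StabilityFinalArgumentProofs
import Mathlib
import HarnessLib

/-!
# The quantum-belief-propagation ODE `d/ds e^{-β(H+sV)} = -(β/2){Φ(s), e^{-β(H+sV)}}` (stub B of line `gauge_qbp_far_seam`, part 3)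

Helper module for route `TcThermcert1`, cruxes K1′ `ThermalStiffnessCeilingU8b8_le_7o44` (item `stmt-Ventures-24560`) and
K1 `ThermalStiffnessCeilingU8b10_le_1o8` (item `stmt-Ventures-26381`), line
`Cruxes/ThermalStiffnessCeilingU8b10_le_1o8/Lines/gauge_qbp_far_seam.lean` v1.3, registered stub B
(`stub_farCutCurrent_of_clustering`), porting Capel–Moscolari–Teufel–Wessel (CMTW), arXiv:2310.09182, Prop. 6 / §10.1.1.

CMTW Prop. 6 (a) (Hastings' quantum belief propagation): for `H(s) = H + sV`,
`d/ds e^{-βH(s)} = -(β/2) (Φ(s) e^{-βH(s)} + e^{-βH(s)} Φ(s))` with `Φ(s) = ∫ f_β(t) τ_t^{H(s)}(V) dt`, a weighted Heisenberg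
average of `V` whose weight `f_β ∈ L¹(ℝ)` has Fourier transform `f̂_β(ω) = tanh(βω/2)/(βω/2)` (CMTW (10.1)–(10.3)). The proof is
a computation in an eigenbasis `H(s) u_a = E_a u_a`: the Duhamel derivative has matrix elements
`-β K_β(E_b, E_a) V_ab` (`K_β` the logarithmic-mean kernel `duhamelKernel` of the tree), the anticommutator has matrix elements
`-(β/2) f̂(E_a - E_b) (e^{-βE_a} + e^{-βE_b}) V_ab`, and the two agree iff the weight satisfies the **kernel identity**
`f̂(y - x) (e^{-βx} + e^{-βy}) = 2 K_β(x, y)` (⟺ `f̂(ω) = tanh(βω/2)/(βω/2)`). This file proves the ODE for an ARBITRARY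
integrable real weight `f` satisfying the kernel identity (hypothesis `hfK`; its discharge for the explicit CMTW weight `f_β` is
a separate scalar computation), and then packages it with parts 1–2 into CMTW Prop. 6 (a): `e^{-βH(s)} = η_s e^{-βH} η_s†` with
`‖η_s‖ ≤ e^{(β/2) ‖f‖₁ ‖V‖ s}` and `η_s` in every subalgebra containing `H` and `V`.

* §1 matrix elements in an eigenbasis (`star u_a ⬝ᵥ (M *ᵥ u_b)`): of `e^{cK}` acting on the left, of the Duhamel integrand and
  of the Duhamel integral (`= K_β(E_b,E_a) · Y_ab`), of `X e^{-βK}` and `e^{-βK} X`; a matrix is determined by them;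
* §2 `hasDerivAt_gibbsWeight_add_smul` (Duhamel form, from the tree's `Matrix.hasDerivAt_exp_add_smul`) and the QBP form
  `hasDerivAt_gibbsWeight_qbp` under `hfK`;
* §3 `exists_qbp_conjugation`: CMTW Prop. 6 (a) for a generic weight (parts 1 + 2 + §2).
Theorems only; nothing about superconductivity in the Hubbard model is proved by anything in this file.

References: CMTW arXiv:2310.09182 Prop. 6, §10.1.1 eq. (10.1)–(10.3) [CapelEtAl2023]; M. B. Hastings, PRB 76 (2007) 201102
(quantum belief propagation); the tree: `Matrix.hasDerivAt_exp_add_smul`, `duhamelKernel` (DLS 1978 kernel),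
`eigenvector_dotProduct_integral_smul_heisenbergEvolution` (Michalakis–Zwolak smoothing map), `exp_smul_mulVec_eigenvectorBasis`,
`eq_zero_of_eigenvector_dotProduct_eq_zero`, `isHermitian_add_real_smul` (MZ final argument), parts 1–2 `exists_qbp_orderedExp`, `continuous_weightedGenerator_comp`,
`norm_weightedGenerator_le`, `isHermitian_weightedGenerator`, `weightedGenerator_mem_subalgebra`.
-/

noncomputable section

open Real Complex Set Filter MeasureTheory
open scoped Topology ComplexConjugate

namespace Summit.Ventures.CertifiedManyBodySolver.Theorems.TcThermcert1.GaugeQbpFarSeam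

open Literature.MathematicalPhysics.QuantumLattice
open Matrix
open scoped Matrix.Norms.L2Operator

variable {n : Type*} [Fintype n] [DecidableEq n]

/-! ## §1 Matrix elements in an eigenbasis -/

/-- Left action of `e^{cK}` on a bra of the eigenbasis: `u_a† e^{cK} = e^{cE_a} u_a†`. [folklore] -/
theorem star_eigenvectorBasis_vecMul_exp_smul {K : Matrix n n ℂ} (hK : K.IsHermitian) (c : ℂ) (a : n) :
    star (hK.eigenvectorBasis a : n → ℂ) ᵥ* NormedSpace.exp (c • K) =
      Complex.exp (c * hK.eigenvalues a) • star (hK.eigenvectorBasis a : n → ℂ) := by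
  have h1 : star (hK.eigenvectorBasis a : n → ℂ) ᵥ* NormedSpace.exp (c • K) =
      star ((NormedSpace.exp (c • K))ᴴ *ᵥ (hK.eigenvectorBasis a : n → ℂ)) := by
    rw [star_mulVec, conjTranspose_conjTranspose]
  have h2 : (NormedSpace.exp (c • K))ᴴ = NormedSpace.exp ((star c) • K) := by
    rw [← Matrix.exp_conjTranspose, conjTranspose_smul, hK.eq]
  rw [h1, h2, exp_smul_mulVec_eigenvectorBasis hK, star_smul]
  congr 1
  rw [Complex.star_def, ← Complex.exp_conj, map_mul, Complex.conj_ofReal, Complex.conj_conj]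

/-- Matrix element of the Duhamel integrand: `u_a† e^{u cK} Y e^{(1-u) cK} u_b = e^{ucE_a} e^{(1-u)cE_b} Y_ab`. [folklore] -/
theorem eigenvector_dotProduct_duhamelIntegrand_mulVec {K : Matrix n n ℂ} (hK : K.IsHermitian)
    (Y : Matrix n n ℂ) (c : ℂ) (u : ℝ) (a b : n) :
    star (hK.eigenvectorBasis a : n → ℂ) ⬝ᵥ
        ((NormedSpace.exp (u • (c • K)) * Y * NormedSpace.exp ((1 - u) • (c • K))) *ᵥ
          (hK.eigenvectorBasis b : n → ℂ)) =
      Complex.exp ((u : ℂ) * c * hK.eigenvalues a) * Complex.exp (((1 - u : ℝ) : ℂ) * c * hK.eigenvalues b) *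
        (star (hK.eigenvectorBasis a : n → ℂ) ⬝ᵥ (Y *ᵥ (hK.eigenvectorBasis b : n → ℂ))) := by
  have e1 : NormedSpace.exp ((1 - u) • (c • K)) *ᵥ (hK.eigenvectorBasis b : n → ℂ) =
      Complex.exp (((1 - u : ℝ) : ℂ) * c * hK.eigenvalues b) • (hK.eigenvectorBasis b : n → ℂ) := by
    rw [← Complex.coe_smul, smul_smul, exp_smul_mulVec_eigenvectorBasis hK, mul_assoc]
  have e2 : star (hK.eigenvectorBasis a : n → ℂ) ᵥ* NormedSpace.exp (u • (c • K)) =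
      Complex.exp ((u : ℂ) * c * hK.eigenvalues a) • star (hK.eigenvectorBasis a : n → ℂ) := by
    rw [← Complex.coe_smul, smul_smul, star_eigenvectorBasis_vecMul_exp_smul hK, mul_assoc]
  rw [← mulVec_mulVec, ← mulVec_mulVec, e1, mulVec_smul, mulVec_smul, dotProduct_smul, dotProduct_mulVec, e2,
    smul_dotProduct, smul_eq_mul, smul_eq_mul]
  ring

/-- The matrix element `M ↦ u† M v` as a linear functional commutes with interval integrals. [folklore] -/
theorem dotProduct_intervalIntegral_mulVec (u v : n → ℂ) {F : ℝ → Matrix n n ℂ} {a b : ℝ}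
    (hF : IntervalIntegrable F volume a b) :
    star u ⬝ᵥ ((∫ x in a..b, F x) *ᵥ v) = ∫ x in a..b, star u ⬝ᵥ (F x *ᵥ v) := by
  let L : Matrix n n ℂ →ₗ[ℂ] ℂ :=
    { toFun := fun M => star u ⬝ᵥ (M *ᵥ v)
      map_add' := fun M N => by simp only [add_mulVec, dotProduct_add]
      map_smul' := fun c M => by simp only [smul_mulVec, dotProduct_smul, RingHom.id_apply] }
  exact ((LinearMap.toContinuousLinearMap L).intervalIntegral_comp_comm hF).symm

/-- **Matrix element of the Duhamel integral**: `u_a† (∫₀¹ e^{-uβK} Y e^{-(1-u)βK} du) u_b = K_β(E_b, E_a) Y_ab` with the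
logarithmic-mean kernel `K_β(x,y) = ∫₀¹ e^{-β(sy + (1-s)x)} ds` (`duhamelKernel`). [cite: CapelEtAl2023, §10.1.1] -/
theorem eigenvector_dotProduct_duhamelIntegral_mulVec {K : Matrix n n ℂ} (hK : K.IsHermitian)
    (Y : Matrix n n ℂ) (β : ℝ) (a b : n) :
    star (hK.eigenvectorBasis a : n → ℂ) ⬝ᵥ
        ((∫ u in (0:ℝ)..1, NormedSpace.exp (u • (-(β : ℂ) • K)) * Y * NormedSpace.exp ((1 - u) • (-(β : ℂ) • K))) *ᵥ
          (hK.eigenvectorBasis b : n → ℂ)) =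
      (duhamelKernel β (hK.eigenvalues b) (hK.eigenvalues a) : ℂ) *
        (star (hK.eigenvectorBasis a : n → ℂ) ⬝ᵥ (Y *ᵥ (hK.eigenvectorBasis b : n → ℂ))) := by
  have hcont := Matrix.continuous_exp_smul_mul_mul_exp (-(β : ℂ) • K) Y (-(β : ℂ) • K)
  rw [dotProduct_intervalIntegral_mulVec _ _ (hcont.intervalIntegrable 0 1)]
  simp_rw [eigenvector_dotProduct_duhamelIntegrand_mulVec hK Y (-(β : ℂ)) _ a b]
  rw [intervalIntegral.integral_mul_const, duhamelKernel, ← intervalIntegral.integral_ofReal]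
  congr 1
  refine intervalIntegral.integral_congr fun u _ => ?_
  rw [← Complex.exp_add, Complex.ofReal_exp]
  congr 1
  push_cast
  ring

/-- `u_a† (X e^{-βK}) u_b = e^{-βE_b} · u_a† X u_b`. [folklore] -/
theorem eigenvector_dotProduct_mul_gibbsWeight_mulVec {K : Matrix n n ℂ} (hK : K.IsHermitian)
    (X : Matrix n n ℂ) (β : ℝ) (a b : n) :
    star (hK.eigenvectorBasis a : n → ℂ) ⬝ᵥ ((X * gibbsWeight β K) *ᵥ (hK.eigenvectorBasis b : n → ℂ)) =
      Complex.exp (-(β : ℂ) * hK.eigenvalues b) *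
        (star (hK.eigenvectorBasis a : n → ℂ) ⬝ᵥ (X *ᵥ (hK.eigenvectorBasis b : n → ℂ))) := by
  rw [← mulVec_mulVec, gibbsWeight, exp_smul_mulVec_eigenvectorBasis hK, mulVec_smul, dotProduct_smul, smul_eq_mul]

/-- `u_a† (e^{-βK} X) u_b = e^{-βE_a} · u_a† X u_b`. [folklore] -/
theorem eigenvector_dotProduct_gibbsWeight_mul_mulVec {K : Matrix n n ℂ} (hK : K.IsHermitian)
    (X : Matrix n n ℂ) (β : ℝ) (a b : n) :
    star (hK.eigenvectorBasis a : n → ℂ) ⬝ᵥ ((gibbsWeight β K * X) *ᵥ (hK.eigenvectorBasis b : n → ℂ)) =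
      Complex.exp (-(β : ℂ) * hK.eigenvalues a) *
        (star (hK.eigenvectorBasis a : n → ℂ) ⬝ᵥ (X *ᵥ (hK.eigenvectorBasis b : n → ℂ))) := by
  rw [← mulVec_mulVec, dotProduct_mulVec, gibbsWeight, star_eigenvectorBasis_vecMul_exp_smul hK, smul_dotProduct,
    smul_eq_mul]

/-- A matrix is determined by its matrix elements in an orthonormal eigenbasis. [folklore] -/
theorem eq_of_eigenvector_dotProduct_mulVec_eq {K : Matrix n n ℂ} (hK : K.IsHermitian) {M N : Matrix n n ℂ}
    (h : ∀ a b, star (hK.eigenvectorBasis a : n → ℂ) ⬝ᵥ (M *ᵥ (hK.eigenvectorBasis b : n → ℂ)) =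
      star (hK.eigenvectorBasis a : n → ℂ) ⬝ᵥ (N *ᵥ (hK.eigenvectorBasis b : n → ℂ))) : M = N := by
  rw [← sub_eq_zero]
  refine eq_zero_of_mulVec_eigenvectorBasis_eq_zero hK fun b =>
    eq_zero_of_eigenvector_dotProduct_eq_zero hK fun a => ?_
  rw [sub_mulVec, dotProduct_sub, h a b, sub_self]

/-! ## §2 The derivative of `s ↦ e^{-β(H + sV)}` -/

/-- **Duhamel form**: `d/ds e^{-β(H+sV)} = ∫₀¹ e^{-uβH(s)} (-βV) e^{-(1-u)βH(s)} du` (the tree's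
`Matrix.hasDerivAt_exp_add_smul`, DLS 1978 eq. (5)). [folklore] -/
theorem hasDerivAt_gibbsWeight_add_smul (β : ℝ) (H V : Matrix n n ℂ) (s₀ : ℝ) :
    HasDerivAt (fun s : ℝ => gibbsWeight β (H + (s : ℂ) • V))
      (∫ u in (0:ℝ)..1, NormedSpace.exp (u • (-(β : ℂ) • (H + (s₀ : ℂ) • V))) * (-(β : ℂ) • V) *
        NormedSpace.exp ((1 - u) • (-(β : ℂ) • (H + (s₀ : ℂ) • V)))) s₀ := by
  have e : ∀ s : ℝ, -(β : ℂ) • H + s • (-(β : ℂ) • V) = -(β : ℂ) • (H + (s : ℂ) • V) := fun s => by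
    rw [smul_add, ← Complex.coe_smul, smul_comm]
  have h := Matrix.hasDerivAt_exp_add_smul (-(β : ℂ) • H) (-(β : ℂ) • V) s₀
  have efun : (fun t : ℝ => NormedSpace.exp (-(β : ℂ) • H + t • (-(β : ℂ) • V))) =
      fun s : ℝ => gibbsWeight β (H + (s : ℂ) • V) := funext fun s => by rw [e, gibbsWeight]
  rw [efun, e] at h
  exact h

/-- **The QBP differential equation** (CMTW Prop. 6 (a), eq. (10.3); Hastings 2007): for Hermitian `H`, `V` and an integrable
real weight `f` satisfying the kernel identity `f̂(y-x)(e^{-βx} + e^{-βy}) = 2K_β(x,y)` (`f̂(ω) = ∫ e^{itω} f(t) dt`;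
equivalently `f̂(ω) = tanh(βω/2)/(βω/2)`),
`d/ds e^{-β(H+sV)} = -(β/2) (Φ(s) e^{-β(H+sV)} + e^{-β(H+sV)} Φ(s))`, `Φ(s) = ∫ f(t) τ_t^{H+sV}(V) dt`.
Proof: both sides have the same matrix elements `-β K_β(E_b,E_a) V_ab` in an eigenbasis of `H + sV`.
[cite: CapelEtAl2023, Proposition 6 (a), §10.1.1 (10.1)–(10.3)] -/
theorem hasDerivAt_gibbsWeight_qbp {H V : Matrix n n ℂ} (hH : H.IsHermitian) (hV : V.IsHermitian) (β : ℝ)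
    {f : ℝ → ℝ} (hf : Integrable f)
    (hfK : ∀ x y : ℝ, (∫ t : ℝ, Complex.exp ((t : ℂ) * ((y : ℂ) - (x : ℂ)) * I) * (f t : ℂ)) *
      (((Real.exp (-(β * x)) + Real.exp (-(β * y)) : ℝ)) : ℂ) = 2 * (duhamelKernel β x y : ℂ))
    (s₀ : ℝ) :
    HasDerivAt (fun s : ℝ => gibbsWeight β (H + (s : ℂ) • V))
      (-(((β / 2 : ℝ) : ℂ) •
        ((∫ t, (f t : ℂ) • heisenbergEvolution (H + (s₀ : ℂ) • V) t V) * gibbsWeight β (H + (s₀ : ℂ) • V) +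
          gibbsWeight β (H + (s₀ : ℂ) • V) * ∫ t, (f t : ℂ) • heisenbergEvolution (H + (s₀ : ℂ) • V) t V))) s₀ := by
  have hK : (H + (s₀ : ℂ) • V).IsHermitian := isHermitian_add_real_smul hH hV s₀
  refine (hasDerivAt_gibbsWeight_add_smul β H V s₀).congr_deriv (eq_of_eigenvector_dotProduct_mulVec_eq hK fun a b => ?_)
  have hw : Integrable (fun t : ℝ => (f t : ℂ)) := hf.ofReal
  have hg := eigenvector_dotProduct_integral_smul_heisenbergEvolution hK hw V a b
  have hid := hfK (hK.eigenvalues b) (hK.eigenvalues a)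
  rw [eigenvector_dotProduct_duhamelIntegral_mulVec hK, smul_mulVec, dotProduct_smul, smul_eq_mul, neg_mulVec,
    dotProduct_neg, smul_mulVec, dotProduct_smul, smul_eq_mul, add_mulVec, dotProduct_add,
    eigenvector_dotProduct_mul_gibbsWeight_mulVec hK, eigenvector_dotProduct_gibbsWeight_mul_mulVec hK, hg]
  simp only [neg_mul] at hid ⊢
  push_cast at hid ⊢
  linear_combination ((β : ℂ) / 2 *
    (star (hK.eigenvectorBasis a : n → ℂ) ⬝ᵥ (V *ᵥ (hK.eigenvectorBasis b : n → ℂ)))) * hid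

/-! ## §3 CMTW Proposition 6 (a): `e^{-β(H+sV)} = η_s e^{-βH} η_s†` -/

omit [Fintype n] [DecidableEq n] in
/-- The segment `s ↦ H + sV` is continuous. [folklore] -/
theorem continuous_add_real_smul (H V : Matrix n n ℂ) : Continuous fun s : ℝ => H + (s : ℂ) • V :=
  continuous_const.add (Continuous.fun_smul Complex.continuous_ofReal continuous_const)

/-- **Quantum belief propagation (CMTW Prop. 6 (a), generic weight).** Let `H`, `V` be Hermitian, `0 ≤ β`, and let `f` be an
integrable real weight satisfying the kernel identity `f̂(y-x)(e^{-βx} + e^{-βy}) = 2K_β(x,y)`. Then there is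
`η : [0,T] → GL` with `η_0 = 1`, `η' = -(β/2) Φ(s) η` (`Φ(s) = ∫ f τ^{H+sV}(V)`), `‖η_s‖ ≤ e^{(β/2)‖f‖₁‖V‖ s}`,
`e^{-β(H+sV)} = η_s e^{-βH} η_s†` for `s ∈ [0,T]`, and `η_s ∈ S` for every subalgebra `S ∋ H, V` (so `η_s` is as local as
`H` and `V`: in the application `S` is the even CAR algebra of the torus and, for the truncated generator, of a region).
With the CMTW weight (`‖f_β‖₁ = 1`) this is exactly Prop. 6 (a): `‖η_s‖ ≤ e^{βs‖V‖/2}`.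
[cite: CapelEtAl2023, Proposition 6 (a)] -/
theorem exists_qbp_conjugation {H V : Matrix n n ℂ} (hH : H.IsHermitian) (hV : V.IsHermitian) {β : ℝ} (hβ : 0 ≤ β)
    {f : ℝ → ℝ} (hf : Integrable f)
    (hfK : ∀ x y : ℝ, (∫ t : ℝ, Complex.exp ((t : ℂ) * ((y : ℂ) - (x : ℂ)) * I) * (f t : ℂ)) *
      (((Real.exp (-(β * x)) + Real.exp (-(β * y)) : ℝ)) : ℂ) = 2 * (duhamelKernel β x y : ℂ))
    (T : ℝ) :
    ∃ η : ℝ → Matrix n n ℂ, η 0 = 1 ∧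
      (∀ s ∈ Icc (0:ℝ) T, HasDerivWithinAt η
        (-(((β / 2 : ℝ) : ℂ) • ∫ t, (f t : ℂ) • heisenbergEvolution (H + (s : ℂ) • V) t V) * η s) (Icc 0 T) s) ∧
      (∀ s ∈ Icc (0:ℝ) T, ‖η s‖ ≤ Real.exp (β / 2 * ((∫ t, |f t|) * ‖V‖) * s)) ∧
      (∀ s ∈ Icc (0:ℝ) T, gibbsWeight β (H + (s : ℂ) • V) = η s * gibbsWeight β H * (η s)ᴴ) ∧
      (∀ S : Subalgebra ℂ (Matrix n n ℂ), H ∈ S → V ∈ S → ∀ s ∈ Icc (0:ℝ) T, η s ∈ S) := by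
  have hKh : ∀ s : ℝ, (H + (s : ℂ) • V).IsHermitian := fun s => isHermitian_add_real_smul hH hV s
  obtain ⟨η, hη0, hηd, hηn, hηE, hηS⟩ := exists_qbp_orderedExp (T := T)
    (Φ := fun s : ℝ => ∫ t, (f t : ℂ) • heisenbergEvolution (H + (s : ℂ) • V) t V)
    (E := fun s : ℝ => gibbsWeight β (H + (s : ℂ) • V))
    (continuous_weightedGenerator_comp (continuous_add_real_smul H V) hKh hf V)
    (fun s => norm_weightedGenerator_le (hKh s) f V) (fun s => isHermitian_weightedGenerator (hKh s) hV hf) hβ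
    (fun s _ => (hasDerivAt_gibbsWeight_qbp hH hV β hf hfK s).hasDerivWithinAt)
  refine ⟨η, hη0, hηd, hηn, fun s hs => ?_, fun S hHS hVS => hηS S fun s => ?_⟩
  · have h := hηE s hs
    simp only [Complex.ofReal_zero, zero_smul, add_zero] at h
    exact h
  · exact weightedGenerator_mem_subalgebra S (hKh s) (S.add_mem hHS (S.smul_mem hVS _)) hVS hf

end Summit.Ventures.CertifiedManyBodySolver.Theorems.TcThermcert1.GaugeQbpFarSeam
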